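import Literature.MathematicalPhysics.QuantumManyBody.EnergyLocalizationDyson
import Literature.MathematicalPhysics.QuantumManyBody.LiebYngvasonTheorem
import HarnessLib

/-!
# LSSY Lemma 5.2, second layer: the localized functional in a small Neumann box

Topic `Literature/MathematicalPhysics/QuantumManyBody`, companion of `EnergyLocalization.lean`
(named fact `LSSY2005_lemma52_periodic`) and of `LiebYngvasonBoxBound.lean` (the box bound
(2.54) of Thm. 2.4, `LSSY2005_boxLowerBound_of_parts`).

The proof of Lemma 5.2 runs the proof of Thm. 2.4 for the **localized functional**
`εT + (1-ε)(T^in + I)` [LSSY2005, (5.9)–(5.14)] instead of `⟨Ψ, HΨ⟩ = T + I`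
(`T^in = ∑ᵢ∫1{tᵢ<R}|∇ᵢΨ|²`, `kineticInside`). This file defines that functional on Neumann
boxes (`locEnergy`, `locGroundStateEnergy`) and proves for it the box bound (2.54) with the
same function `K = lyK` (`locBoxLowerBound`): the printed proof of (2.54) [pp. 15–16] uses the
full kinetic energy only through `εT` (Temple's inequality with the gap of `εT`), while Dyson's
bound `(1-ε)H ≥ (1-ε)aW_R` (2.43) needs only `T^in` (`Dyson.dysonBound_boxN_inside`). The proof
text is that of `LSSY2005_boxLowerBound_of_parts` with this one change.

## References

* [LSSY2005] E. H. Lieb, R. Seiringer, J. P. Solovej, J. Yngvason, *The Mathematics of the Bose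
  Gas and its Condensation*, Oberwolfach Seminars 34, Birkhäuser 2005 (arXiv:cond-mat/0610117):
  (2.43)–(2.51) p. 15, (2.54)–(2.56) p. 16; Lemma 5.2 (5.9)–(5.14), p. 25.
-/

noncomputable section

open MeasureTheory Filter Metric
open scoped ENNReal NNReal

namespace Literature.MathematicalPhysics.QuantumManyBody.BoseGas

/-! ### The localized functional on a Neumann box -/

/-- **The localized energy functional** `εT + (1-ε)(T^in_R + I)` of a Neumann trial state on
`Λ_ℓ^n`: `T = ∫|∇Ψ|²`, `T^in_R = ∫∑ᵢ1{tᵢ<R}|∇ᵢΨ|²`, `I = ∫∑_{i<j}v|Ψ|²` ((5.9)–(5.13) with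
`φ = 0`, transported to a box). [cite: LSSY2005, Lemma 5.2 (5.9)–(5.13)] -/
def locEnergy (ε R : ℝ) (v : ℝ → ℝ≥0∞) {n : ℕ} {ℓ : ℝ} (Ψ : NeumannTrialState n ℓ) : ℝ≥0∞ :=
  ENNReal.ofReal ε * (∫⁻ X in boxN n ℓ, kineticDensity Ψ.ψ X) +
    ENNReal.ofReal (1 - ε) *
      ∫⁻ X in boxN n ℓ, kineticInside R Ψ.ψ X + interaction v X * (‖Ψ.ψ X‖₊ : ℝ≥0∞) ^ 2

/-- The infimum of the localized functional over Neumann trial states ("`E₀(n,ℓ)`" of the cell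
method for the localized functional). [cite: LSSY2005, Lemma 5.2 (5.14) and (2.52)] -/
def locGroundStateEnergy (ε R : ℝ) (v : ℝ → ℝ≥0∞) (n : ℕ) (ℓ : ℝ) : ℝ≥0∞ :=
  ⨅ Ψ : NeumannTrialState n ℓ, locEnergy ε R v Ψ

/-- Variational principle for the localized functional. [folklore] -/
theorem locGroundStateEnergy_le (ε R : ℝ) (v : ℝ → ℝ≥0∞) {n : ℕ} {ℓ : ℝ}
    (Ψ : NeumannTrialState n ℓ) : locGroundStateEnergy ε R v n ℓ ≤ locEnergy ε R v Ψ :=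
  iInf_le _ Ψ

/-- The localized functional is dominated by the energy: `εT + (1-ε)(T^in + I) ≤ T + I` for
`0 ≤ ε ≤ 1`. [cite: LSSY2005, Lemma 5.2 (5.9)] -/
theorem locEnergy_le_neumannEnergy {ε : ℝ} (hε0 : 0 ≤ ε) (hε1 : ε ≤ 1) (R : ℝ) (v : ℝ → ℝ≥0∞)
    {n : ℕ} {ℓ : ℝ} (Ψ : NeumannTrialState n ℓ) : locEnergy ε R v Ψ ≤ neumannEnergy v Ψ := by
  have hsplit : ENNReal.ofReal ε + ENNReal.ofReal (1 - ε) = 1 := by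
    rw [← ENNReal.ofReal_add hε0 (by linarith), add_sub_cancel, ENNReal.ofReal_one]
  calc locEnergy ε R v Ψ ≤ ENNReal.ofReal ε * neumannEnergy v Ψ +
        ENNReal.ofReal (1 - ε) * neumannEnergy v Ψ := by
        unfold locEnergy neumannEnergy
        gcongr ENNReal.ofReal ε * ?_ + ENNReal.ofReal (1 - ε) * ?_
        · exact lintegral_mono fun X => le_self_add
        · exact lintegral_mono fun X => by
            gcongr; exact kineticInside_le_kineticDensity R Ψ.ψ X
    _ = neumannEnergy v Ψ := by rw [← add_mul, hsplit, one_mul]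

section BoxAssembly

variable {n : ℕ}

set_option maxHeartbeats 1600000 in
/-- **(2.54) for the localized functional.** For `n` particles in a Neumann box of side `ℓ`,
`0 < ε < 1`, `R₀ < R < ℓ/2` and a positive Temple denominator,
`inf_Ψ [εT + (1-ε)(T^in_R + I)] ≥ (4πa/ℓ³) n(n-1) K(n,ℓ)` with the same `K = lyK a R₀ R ε ℓ n` as
the box bound (2.54) of Thm. 2.4: the printed argument — Dyson (2.43), the first-order bounds
(2.44), (2.50), and Temple's inequality (2.46)–(2.49) with the Neumann gap of `εT` — verbatim,
except that Dyson's bound is fed only `T^in` (`Dyson.dysonBound_boxN_inside`). This is the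
content of (5.14) in one box. [cite: LSSY2005, Lemma 5.2 (5.14) and (2.43)–(2.56)] -/
theorem locBoxLowerBound (v : ℝ → ℝ≥0∞) (R₀ : ℝ) (hv : Measurable v) (hR₀ : 0 ≤ R₀)
    (hrange : ∀ r, R₀ < r → v r = 0) (n : ℕ) (ℓ ε R : ℝ) (hε : 0 < ε)
    (hε1 : ε < 1) (hR : R₀ < R) (h2R : 2 * R < ℓ)
    (hden : 0 < Real.pi * ε / ℓ ^ 2 -
      4 * (scatteringLength v).toReal * n * (n - 1) / ℓ ^ 3) :
    ENNReal.ofReal (4 * Real.pi * (scatteringLength v).toReal / ℓ ^ 3 * n * (n - 1) *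
        lyK (scatteringLength v).toReal R₀ R ε ℓ n) ≤ locGroundStateEnergy ε R v n ℓ := by
  set a := (scatteringLength v).toReal with ha_def
  have hRpos : 0 < R := hR₀.trans_lt hR
  have hℓ : 0 < ℓ := by linarith
  have ha0 : 0 ≤ a := by rw [ha_def]; exact ENNReal.toReal_nonneg
  have hπ := Real.pi_pos
  have hπ4 := Real.pi_le_four
  have hΔ : 0 < R ^ 3 - R₀ ^ 3 := sub_pos.2 (pow_lt_pow_left₀ hR hR₀ three_ne_zero)
  set D := Real.pi * ε / ℓ ^ 2 - 4 * a * n * (n - 1) / ℓ ^ 3 with hD_def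
  set τ := 3 * a * n / (Real.pi * (R ^ 3 - R₀ ^ 3) * D) with hτ_def
  set y := 4 * Real.pi * R ^ 3 / (3 * ℓ ^ 3) with hy_def
  set x := 4 * Real.pi * R₀ ^ 3 / (3 * ℓ ^ 3) with hx_def
  have hK : lyK a R₀ R ε ℓ n = (1 - ε) * (1 - 2 * R / ℓ) ^ 3 * (1 - y) ^ (n - 1) * (1 - τ) := by
    simp only [lyK, hy_def, hτ_def, hD_def]
  -- `0 ≤ x ≤ y ≤ 1`
  have hx0 : 0 ≤ x := by rw [hx_def]; positivity
  have hxy : x ≤ y := by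
    rw [hx_def, hy_def]
    gcongr
  have hy1 : y ≤ 1 := by
    rw [hy_def, div_le_one (by positivity)]
    have h8 : R ^ 3 ≤ ℓ ^ 3 / 8 := by
      have : R ≤ ℓ / 2 := by linarith
      calc R ^ 3 ≤ (ℓ / 2) ^ 3 := pow_le_pow_left₀ hRpos.le this 3
        _ = ℓ ^ 3 / 8 := by ring
    nlinarith [pow_pos hℓ 3]
  have h2Rℓ : 0 < 1 - 2 * R / ℓ := by
    rw [sub_pos, div_lt_one hℓ]; exact h2R
  have hτ0 : 0 ≤ τ := by rw [hτ_def]; positivity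
  -- trivial cases: `n ≤ 1`, or `K ≤ 0`
  rcases lt_or_ge n 2 with hn2 | hn2
  · have : (n : ℝ) * (n - 1) = 0 := by
      interval_cases n <;> simp
    rw [show 4 * Real.pi * a / ℓ ^ 3 * n * (n - 1) * lyK a R₀ R ε ℓ n =
      4 * Real.pi * a / ℓ ^ 3 * (n * (n - 1)) * lyK a R₀ R ε ℓ n by ring, this]
    simp
  rcases le_or_gt (1 - τ) 0 with hτ1 | hτ1
  · have hK0 : lyK a R₀ R ε ℓ n ≤ 0 := by
      rw [hK]
      exact mul_nonpos_of_nonneg_of_nonpos (by positivity) hτ1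
    have : 4 * Real.pi * a / ℓ ^ 3 * n * (n - 1) * lyK a R₀ R ε ℓ n ≤ 0 := by
      have hnn : (0 : ℝ) ≤ 4 * Real.pi * a / ℓ ^ 3 * n * (n - 1) := by
        have : (1 : ℝ) ≤ n := by exact_mod_cast (by omega : 1 ≤ n)
        have : (0 : ℝ) ≤ n - 1 := by linarith
        positivity
      exact mul_nonpos_of_nonneg_of_nonpos hnn hK0
    rw [ENNReal.ofReal_of_nonpos this]
    exact bot_le
  -- main case: `n ≥ 2`, `τ < 1`
  have hn1 : (1 : ℝ) ≤ n := by exact_mod_cast (by omega : 1 ≤ n)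
  have hncast : ((n - 1 : ℕ) : ℝ) = n - 1 := by
    rw [Nat.cast_sub (by omega : 1 ≤ n), Nat.cast_one]
  have hnn1 : (0 : ℝ) ≤ n * (n - 1) := mul_nonneg (by positivity) (by linarith)
  refine le_iInf fun Ψ => ?_
  set ψ := Ψ.ψ with hψ_def
  set E := locEnergy ε R v Ψ with hE_def
  rcases eq_or_ne E ⊤ with hEtop | hEtop
  · rw [hEtop]; exact le_top
  -- the pieces of the energy
  set T := ∫⁻ X in boxN n ℓ, kineticDensity ψ X with hT_def
  set Tin := ∫⁻ X in boxN n ℓ, kineticInside R ψ X with hTin_def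
  set I := ∫⁻ X in boxN n ℓ, interaction v X * (‖ψ X‖₊ : ℝ≥0∞) ^ 2 with hI_def
  have hTinI_eq : Tin + I =
      ∫⁻ X in boxN n ℓ, kineticInside R ψ X + interaction v X * (‖ψ X‖₊ : ℝ≥0∞) ^ 2 :=
    (lintegral_add_left (measurable_kineticInside R ψ) _).symm
  have hETI : E = ENNReal.ofReal ε * T + ENNReal.ofReal (1 - ε) * (Tin + I) := by
    rw [hE_def, locEnergy, hT_def, hTinI_eq]
  have hε0 : ENNReal.ofReal ε ≠ 0 := by simpa using hε
  have hε1' : ENNReal.ofReal (1 - ε) ≠ 0 := by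
    have : 0 < 1 - ε := by linarith
    simpa using this
  have hT : T ≠ ⊤ := fun h => hEtop (by rw [hETI, h, ENNReal.mul_top hε0, top_add])
  have hTinI : Tin + I ≠ ⊤ := fun h => hEtop (by rw [hETI, h, ENNReal.mul_top hε1', add_top])
  -- Dyson (2.43), refined: only `T^in` is used
  set WΨ := ∫⁻ X in boxN n ℓ, dysonW R₀ R X * (‖ψ X‖₊ : ℝ≥0∞) ^ 2 with hWΨ_def
  have hDyson : scatteringLength v * WΨ ≤ Tin + I := by
    rw [hTinI_eq]
    exact Dyson.dysonBound_boxN_inside hv hR₀ hrange n ℓ hR Ψ.contDiff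
  set Cw := (n : ℝ≥0∞) * ENNReal.ofReal (3 / (R ^ 3 - R₀ ^ 3)) with hCw_def
  have hCw : Cw ≠ ⊤ := ENNReal.mul_ne_top (ENNReal.natCast_ne_top n) ENNReal.ofReal_ne_top
  have hWle : ∀ X : Config n, dysonW R₀ R X ≤ Cw := fun X => dysonW_le X
  have hWΨ : WΨ ≠ ⊤ := by
    refine ne_top_of_le_ne_top (ENNReal.mul_ne_top hCw ENNReal.one_ne_top) ?_
    calc WΨ ≤ ∫⁻ X in boxN n ℓ, Cw * (‖ψ X‖₊ : ℝ≥0∞) ^ 2 :=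
          lintegral_mono fun X => mul_le_mul_left (hWle X) _
      _ = Cw * 1 := by
          rw [lintegral_const_mul' _ _ hCw, Ψ.norm_eq]
  -- the mean of `W_R`
  set Wbar := ∫⁻ X in boxN n ℓ, dysonW R₀ R X with hWbar_def
  have hvol : volume (boxN n ℓ) = ENNReal.ofReal (ℓ ^ (3 * n)) := by
    rw [volume_boxN, ← ENNReal.ofReal_pow hℓ.le, ← ENNReal.ofReal_pow (by positivity), ← pow_mul]
  have hL : (volume (boxN n ℓ)).toReal = ℓ ^ (3 * n) := by
    rw [hvol, ENNReal.toReal_ofReal (by positivity)]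
  have hWbar : Wbar ≠ ⊤ := by
    refine ne_top_of_le_ne_top (ENNReal.mul_ne_top hCw (hvol ▸ ENNReal.ofReal_ne_top)) ?_
    calc Wbar ≤ ∫⁻ _X in boxN n ℓ, Cw := lintegral_mono fun X => hWle X
      _ = Cw * volume (boxN n ℓ) := setLIntegral_const _ _
  -- (2.44), upper bound, in reals
  have hWup : Wbar.toReal ≤ n * (n - 1) * (4 * Real.pi * (ℓ ^ 3) ^ (n - 1)) := by
    have h := lintegral_dysonW_le (n := n) hR₀ hR ℓ
    have hne : (n : ℝ≥0∞) * ((n - 1 : ℕ) : ℝ≥0∞) *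
        (ENNReal.ofReal (4 * Real.pi) * (ENNReal.ofReal ℓ ^ 3) ^ (n - 1)) ≠ ⊤ :=
      ENNReal.mul_ne_top (ENNReal.mul_ne_top (ENNReal.natCast_ne_top _) (ENNReal.natCast_ne_top _))
        (ENNReal.mul_ne_top ENNReal.ofReal_ne_top
          (ENNReal.pow_ne_top (ENNReal.pow_ne_top ENNReal.ofReal_ne_top)))
    have := ENNReal.toReal_mono hne h
    rw [ENNReal.toReal_mul, ENNReal.toReal_mul, ENNReal.toReal_mul, ENNReal.toReal_natCast,
      ENNReal.toReal_natCast, ENNReal.toReal_ofReal (by positivity), ENNReal.toReal_pow,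
      ENNReal.toReal_pow, ENNReal.toReal_ofReal hℓ.le, hncast] at this
    exact this
  -- (2.44), lower bound, in reals
  set A := ℓ ^ 3 - R₀ ^ 3 * (Real.pi * 4 / 3) with hA_def
  set B := ℓ ^ 3 - R ^ 3 * (Real.pi * 4 / 3) with hB_def
  have hAx : A = ℓ ^ 3 * (1 - x) := by
    rw [hA_def, hx_def]; field_simp
  have hBy : B = ℓ ^ 3 * (1 - y) := by
    rw [hB_def, hy_def]; field_simp
  have hB0 : 0 ≤ B := by rw [hBy]; exact mul_nonneg (by positivity) (sub_nonneg.2 hy1)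
  have hBA : B ≤ A := by rw [hAx, hBy]; gcongr
  have hA0 : 0 ≤ A := hB0.trans hBA
  have hABpow : B ^ (n - 1) ≤ A ^ (n - 1) := pow_le_pow_left₀ hB0 hBA _
  set low := (n : ℝ) * (3 / (R ^ 3 - R₀ ^ 3) * (A ^ (n - 1) - B ^ (n - 1)) * (ℓ - 2 * R) ^ 3)
    with hlow_def
  have hlowE : ENNReal.ofReal low = n * (ENNReal.ofReal (3 / (R ^ 3 - R₀ ^ 3)) *
      (ENNReal.ofReal A ^ (n - 1) - ENNReal.ofReal B ^ (n - 1)) *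
        ENNReal.ofReal (ℓ - 2 * R) ^ 3) := by
    rw [hlow_def, ENNReal.ofReal_mul (Nat.cast_nonneg n), ENNReal.ofReal_natCast,
      ENNReal.ofReal_mul (mul_nonneg (div_nonneg (by norm_num) hΔ.le) (sub_nonneg.2 hABpow)),
      ENNReal.ofReal_mul (div_nonneg (by norm_num) hΔ.le), ENNReal.ofReal_sub _ (pow_nonneg hB0 _),
      ENNReal.ofReal_pow hA0, ENNReal.ofReal_pow hB0, ENNReal.ofReal_pow (by linarith)]
  have hWlow : low ≤ Wbar.toReal := by
    have h := le_lintegral_dysonW (n := n) (ℓ := ℓ) hR₀ hR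
    rw [← hA_def, ← hB_def, ← hlowE] at h
    exact (ENNReal.ofReal_le_iff_le_toReal hWbar).1 h
  -- Temple's inequality for `εT + (1-ε) a W_R`
  set b := (1 - ε) * a with hb_def
  have hb0 : 0 ≤ b := mul_nonneg (by linarith) ha0
  have hba : b ≤ a := by rw [hb_def]; nlinarith
  set V : Config n → ℝ := fun X => b * (dysonW R₀ R X).toReal with hV_def
  have hVm : Measurable V := (measurable_dysonW R₀ R).ennreal_toReal.const_mul b
  have hV0 : ∀ X, 0 ≤ V X := fun X => mul_nonneg hb0 ENNReal.toReal_nonneg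
  have hWreal : ∀ X : Config n, (dysonW R₀ R X).toReal ≤ n * (3 / (R ^ 3 - R₀ ^ 3)) := by
    intro X
    have := ENNReal.toReal_mono hCw (hWle X)
    rwa [hCw_def, ENNReal.toReal_mul, ENNReal.toReal_natCast,
      ENNReal.toReal_ofReal (div_nonneg (by norm_num) hΔ.le)] at this
  have hVb : ∀ X, V X ≤ b * (n * (3 / (R ^ 3 - R₀ ^ 3))) := fun X =>
    mul_le_mul_of_nonneg_left (hWreal X) hb0
  have hIV : ∫ X in boxN n ℓ, V X = b * Wbar.toReal := by
    simp only [hV_def]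
    rw [integral_const_mul, integral_toReal_boxN (measurable_dysonW R₀ R) hCw hWle]
  have hIV2 : ∫ X in boxN n ℓ, V X ^ 2 ≤ b * (n * (3 / (R ^ 3 - R₀ ^ 3))) * (b * Wbar.toReal) := by
    have hpt : ∀ X, V X ^ 2 ≤ b * (n * (3 / (R ^ 3 - R₀ ^ 3))) * V X := by
      intro X
      rw [sq]
      exact mul_le_mul_of_nonneg_right (hVb X) (hV0 X)
    calc ∫ X in boxN n ℓ, V X ^ 2 ≤ ∫ X in boxN n ℓ, b * (n * (3 / (R ^ 3 - R₀ ^ 3))) * V X := by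
          refine integral_mono_of_nonneg (Filter.Eventually.of_forall fun X => sq_nonneg _) ?_
            (Filter.Eventually.of_forall hpt)
          exact (integrableOn_boxN_of_bound hVm.aestronglyMeasurable _ fun X _ => by
            rw [Real.norm_of_nonneg (hV0 X)]; exact hVb X).const_mul _
      _ = b * (n * (3 / (R ^ 3 - R₀ ^ 3))) * (b * Wbar.toReal) := by
          rw [integral_const_mul, hIV]
  have hIVψ : ∫ X in boxN n ℓ, V X * ‖ψ X‖ ^ 2 = b * WΨ.toReal := by
    have h1 : ∀ X, V X * ‖ψ X‖ ^ 2 =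
        b * (dysonW R₀ R X * (‖ψ X‖₊ : ℝ≥0∞) ^ 2).toReal := by
      intro X
      rw [hV_def, ENNReal.toReal_mul, ENNReal.toReal_pow, ENNReal.coe_toReal, coe_nnnorm, mul_assoc]
    simp_rw [h1]
    rw [integral_const_mul]
    congr 1
    obtain ⟨Cψ, hCψ⟩ := exists_bound_on_boxN Ψ.contDiff.continuous ℓ
    refine integral_toReal ((measurable_dysonW R₀ R).mul
      (measurable_normSq Ψ.contDiff.continuous)).aemeasurable ?_
    exact Filter.Eventually.of_forall fun X => ENNReal.mul_lt_top
      ((hWle X).trans_lt hCw.lt_top) (ENNReal.pow_lt_top ENNReal.coe_lt_top)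
  -- the gap condition
  set g := ε * Real.pi ^ 2 / ℓ ^ 2 with hg_def
  set m := (∫ X in boxN n ℓ, V X) / (volume (boxN n ℓ)).toReal with hm_def
  have hm : m = b * Wbar.toReal / ℓ ^ (3 * n) := by rw [hm_def, hIV, hL]
  have hm0 : 0 ≤ m := by rw [hm]; positivity
  have hℓ3n : ℓ ^ (3 * n) = ℓ ^ 3 * (ℓ ^ 3) ^ (n - 1) := by
    rw [← pow_mul, ← pow_add]
    congr 1
    omega
  have hm_up : m ≤ b * (4 * Real.pi * n * (n - 1) / ℓ ^ 3) := by
    rw [hm, hℓ3n]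
    have hℓ3 : 0 < ℓ ^ 3 := pow_pos hℓ 3
    have hℓ3n' : 0 < (ℓ ^ 3) ^ (n - 1) := pow_pos hℓ3 _
    rw [div_le_iff₀ (mul_pos hℓ3 hℓ3n')]
    calc b * Wbar.toReal ≤ b * (n * (n - 1) * (4 * Real.pi * (ℓ ^ 3) ^ (n - 1))) :=
          mul_le_mul_of_nonneg_left hWup hb0
      _ = b * (4 * Real.pi * n * (n - 1) / ℓ ^ 3) * (ℓ ^ 3 * (ℓ ^ 3) ^ (n - 1)) := by
          field_simp
  have hgm : Real.pi * D ≤ g - m := by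
    have : b * (4 * Real.pi * n * (n - 1) / ℓ ^ 3) ≤ a * (4 * Real.pi * n * (n - 1) / ℓ ^ 3) :=
      mul_le_mul_of_nonneg_right hba (by positivity)
    have hDexp : Real.pi * D = g - a * (4 * Real.pi * n * (n - 1) / ℓ ^ 3) := by
      rw [hD_def, hg_def]; ring
    rw [hDexp]
    linarith
  have hDpos : 0 < Real.pi * D := mul_pos hπ hden
  have hgap : m < g := by linarith
  have hkin : T ≠ ⊤ := hT
  have hTemple := temple_bound neumannPoincare_boxN_holds hℓ Ψ hVm hV0 hVb hε hkin hgap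
  rw [← hm_def, hIVψ] at hTemple
  -- `E = εT + (1-ε)(T^in + I) ≥ εT + (1-ε) a W_R ≥ Temple`
  have hEreal : ε * T.toReal + b * WΨ.toReal ≤ E.toReal := by
    have h1 : a * WΨ.toReal ≤ (Tin + I).toReal := by
      have := ENNReal.toReal_mono hTinI hDyson
      rwa [ENNReal.toReal_mul, ← ha_def] at this
    rw [hETI, ENNReal.toReal_add (ENNReal.mul_ne_top ENNReal.ofReal_ne_top hT)
        (ENNReal.mul_ne_top ENNReal.ofReal_ne_top hTinI),
      ENNReal.toReal_mul, ENNReal.toReal_mul, ENNReal.toReal_ofReal hε.le,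
      ENNReal.toReal_ofReal (by linarith : (0 : ℝ) ≤ 1 - ε), hb_def]
    have h2 := mul_le_mul_of_nonneg_left h1 (sub_nonneg.2 hε1.le)
    linarith [h2]
  -- Temple's error term: `⟨V²⟩/(g - m) ≤ τ m`
  have hM2 : (∫ X in boxN n ℓ, V X ^ 2) / (volume (boxN n ℓ)).toReal ≤
      b * (n * (3 / (R ^ 3 - R₀ ^ 3))) * m := by
    rw [hm_def, hL, ← mul_div_assoc]
    exact div_le_div_of_nonneg_right (hIV2.trans_eq (by rw [hIV])) (by positivity)
  have herr : (∫ X in boxN n ℓ, V X ^ 2) / (volume (boxN n ℓ)).toReal / (g - m) ≤ τ * m := by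
    calc (∫ X in boxN n ℓ, V X ^ 2) / (volume (boxN n ℓ)).toReal / (g - m)
        ≤ b * (n * (3 / (R ^ 3 - R₀ ^ 3))) * m / (Real.pi * D) := by
          refine div_le_div₀ (by positivity) hM2 hDpos hgm
      _ ≤ a * (n * (3 / (R ^ 3 - R₀ ^ 3))) * m / (Real.pi * D) := by
          gcongr
      _ = τ * m := by
          rw [hτ_def]
          field_simp
  have hmain : m * (1 - τ) ≤ E.toReal := by
    have := hTemple.trans hEreal
    nlinarith
  -- the lower bound on `m` and the final algebra
  have hm_low : b * low / ℓ ^ (3 * n) ≤ m := by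
    rw [hm]
    exact div_le_div_of_nonneg_right (mul_le_mul_of_nonneg_left hWlow hb0) (by positivity)
  have hfinal : 4 * Real.pi * a / ℓ ^ 3 * n * (n - 1) * lyK a R₀ R ε ℓ n ≤
      b * low / ℓ ^ (3 * n) * (1 - τ) := by
    rw [hK, hlow_def, hℓ3n, hb_def]
    have hmv := mul_sub_mul_pow_le_pow_sub_pow hxy (hx0.trans hxy) hy1 (n - 1)
    rw [hncast] at hmv
    -- `A^(n-1) - B^(n-1) = (ℓ³)^(n-1) ((1-x)^(n-1) - (1-y)^(n-1))`
    have hAB : A ^ (n - 1) - B ^ (n - 1) =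
        (ℓ ^ 3) ^ (n - 1) * ((1 - x) ^ (n - 1) - (1 - y) ^ (n - 1)) := by
      rw [hAx, hBy, mul_pow, mul_pow]; ring
    have hyx : y - x = 4 * Real.pi * (R ^ 3 - R₀ ^ 3) / (3 * ℓ ^ 3) := by
      rw [hy_def, hx_def]; field_simp
    rw [hAB]
    have hℓ3 : 0 < ℓ ^ 3 := pow_pos hℓ 3
    have hℓ3n' : 0 < (ℓ ^ 3) ^ (n - 1) := pow_pos hℓ3 _
    -- reduce to the mean-value bound
    have key : 4 * Real.pi * a / ℓ ^ 3 * n * (n - 1) *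
        ((1 - ε) * (1 - 2 * R / ℓ) ^ 3 * (1 - y) ^ (n - 1) * (1 - τ)) =
        (1 - ε) * a * (n * (3 / (R ^ 3 - R₀ ^ 3) * ((ℓ ^ 3) ^ (n - 1) *
          ((n - 1) * (y - x) * (1 - y) ^ (n - 1))) * (ℓ - 2 * R) ^ 3)) /
          (ℓ ^ 3 * (ℓ ^ 3) ^ (n - 1)) * (1 - τ) := by
      rw [hyx]
      field_simp
    rw [key]
    have hpos : 0 ≤ (1 - ε) * a * (n * (3 / (R ^ 3 - R₀ ^ 3))) * (ℓ - 2 * R) ^ 3 /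
        (ℓ ^ 3 * (ℓ ^ 3) ^ (n - 1)) * (1 - τ) * (ℓ ^ 3) ^ (n - 1) := by
      have : 0 ≤ ℓ - 2 * R := by linarith
      have : 0 ≤ 1 - ε := by linarith
      positivity
    have := mul_le_mul_of_nonneg_left hmv hpos
    calc _ = (1 - ε) * a * (n * (3 / (R ^ 3 - R₀ ^ 3))) * (ℓ - 2 * R) ^ 3 /
          (ℓ ^ 3 * (ℓ ^ 3) ^ (n - 1)) * (1 - τ) * (ℓ ^ 3) ^ (n - 1) *
          ((n - 1) * (y - x) * (1 - y) ^ (n - 1)) := by ring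
      _ ≤ (1 - ε) * a * (n * (3 / (R ^ 3 - R₀ ^ 3))) * (ℓ - 2 * R) ^ 3 /
          (ℓ ^ 3 * (ℓ ^ 3) ^ (n - 1)) * (1 - τ) * (ℓ ^ 3) ^ (n - 1) *
          ((1 - x) ^ (n - 1) - (1 - y) ^ (n - 1)) := this
      _ = _ := by ring
  -- conclusion
  calc ENNReal.ofReal (4 * Real.pi * a / ℓ ^ 3 * n * (n - 1) * lyK a R₀ R ε ℓ n)
      ≤ ENNReal.ofReal E.toReal := by
        refine ENNReal.ofReal_le_ofReal (hfinal.trans (le_trans ?_ hmain))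
        exact mul_le_mul_of_nonneg_right hm_low hτ1.le
    _ = E := ENNReal.ofReal_toReal hEtop

end BoxAssembly

end Literature.MathematicalPhysics.QuantumManyBody.BoseGas

end
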